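import Summits.CriticalPhenomena.PercolationContinuityZ3.Theorems.PercNearOneGluingNoHeavyQuantShapeSibling
import Summits.CriticalPhenomena.PercolationContinuityZ3.Theorems.PercNearOneGluingNoHeavyQuantShapePieceBlob
import Summits.CriticalPhenomena.PercolationContinuityZ3.Theorems.PercNearOneGluingNoHeavyQuantShapeHubGeneral
import Summits.CriticalPhenomena.PercolationContinuityZ3.Theorems.PercNearOneGluingNoHeavyQuantGluedChildrenForest
import HarnessLib

/-!
# QUANT lane R8, T-DEC: EVERY FOREST OF GLUED SIBLINGS `R^lo[q₁](R^K[g₁]) ⊔ … ⊔ R^lo[q_k](R^K[g_k])` OF A COMMON SHAPE `lo < K ≤ 3lo/2`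
# (`mᵢ = qᵢ(lo + Kgᵢ) ≥ 2lo`), EVERY WIDTH, IS SDEC AT EVERY FLOOR `x ≤ min qᵢgᵢ` — ORACLE-FREE (census-1 gen 31; the far-giant family
# with a short glued tail, shape-general form of `sdec_gluedChildren_forest`)

builds on p205010 (kernel theorem, internal audit signed; external expert review pending)

Support file (`--supports stmt-CriticalPhenomena-4575`), QUANT lane seat prim-quant-census-1 (gen 31); memo
`run/shared/lean/prim/quant/prim-quant-census-1/g31/HUB-GENERAL-G31.md` §3.  Theorems only (no definitions), standard axioms, no sorries.  Uses the shape
hub of every width `sdec_sHub` (`…QuantShapeHubGeneral`), the lone piece beside a big blob `sdec_pieceBlob` (`…QuantShapePieceBlob`, needs `K ≤ 2lo`),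
the glued-sibling tools `gate_shapeSib_eq_mix` / `shapeSib_params` / `shapeSib_laws` / `sdec_shapeSib` / `sdec_blob_step` / `sp_laws` / `gateBlob_laws`
(`…QuantShapeSibling`), `lconv_mix_right`, `sdec_mix_laws`, `lconv_assoc` / `lconv_comm` / `lconv_delta_left/right`, `flaw_facts`.

THE FAMILY.  `R^lo[q](R^K[g])` = `lo` root relays under the gate `q`, carrying one glued block of `K` relays at gate `g`: sub-forest law
`S(g) = {lo: 1−g, lo+K: g}` (arm-1 g49's `gluedSib lo K q g ·`, there SDEC only for IDENTICAL siblings with `k·q·(lo+Kg) ≤ 4lo` — a width cap).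
For `m = q(lo+Kg) ≥ 2lo` the canonical piece `S(γ)`, `γ = (m−lo)/K ≥ lo/K ≥ 2/3`, is a FAR GIANT (`Kγ ≥ lo`, `γ < x` allowed), so the sibling is
heavy-unfloored — in the residue of the node `SiblingStep`; arm-1 g57's residue sample `R²[½](R⁹[.99])` has `K = 9 > 3lo/2` (not covered).

THE PROOF = the k-FOLD PIECE EXPANSION of `…QuantGluedChildrenForest` verbatim with `3 ↦ lo+K`: `gate S(g) q = α·blob_B(m/B) + (1−α)·S(γ)`
(`gate_shapeSib_eq_mix`), `sHub P ∗ flaw (s :: L) = α·(G ∗ blob_B(m/B)) + (1−α)·(sHub (γ::P) ∗ flaw L)` (`shapeForest_piece`).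
* **`shapeForest_inv`** — for every `L` (glued siblings of shape `(lo,K)`, `mᵢ ≥ 2lo`, floor `x ≤ qᵢgᵢ`) and prefix `P` (`lo ≤ Kγ`, `γ < 1`,
  `x(lo+K) ≤ lo + Kγ`): (1) `G = sHub P ∗ flaw L` is a probability law with mean `Σ_P (lo+Kγ) + fmean L`; (2) `G` is SDEC unless `|P| = 1 ∧ L = []`;
  (3) `G ∗ gate δ_B(θ)` is SDEC for every big heavy blob `2lo ≤ Bθ`, `θ < 1`, `x ≤ θ`.  Base: `sdec_sHub` / `sdec_pieceBlob` / `sdec_blob_step`;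
  step: the corner `P = [] ∧ L = []` is `sdec_shapeSib`.
* **`sdec_shapeForest`** — `lo < K`, `2K ≤ 3lo`; `∀ L`, every sibling `⟨q,·,·,lo+K,S(g)⟩` with `0<q,g<1`, `q(lo+Kg) ≥ 2lo`, `x ≤ qg`; `0 < x` ⟹
  **`SDEC x (ftop L) (flaw L)`**.  `shapeSibs_ftop_fmean`: `ftop L = (lo+K)k`, `x·ftop L ≤ fmean L`.
Numerics: memo §3 / kit j290495 (hubs of 15 shapes × widths 2–5: 12 870, all SDEC), code/exp8.py (piece ∗ blob, 12 shapes, 0 failures).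

HONEST STATUS.  An unconditional SDEC family of every width inside the heavy-unfloored residue, for the shapes `lo < K ≤ 3lo/2` (e.g. `R²(R³)`, `R³(R⁴)`,
`R⁴(R⁵)`, `R⁴(R⁶)`); longer tails (`K > 3lo/2`) need cost routes already at the hub level (kit j290495) — open; `SiblingStep` (all tree-OK forests),
`GluedDominated'`, `SDECConvClosed`, `FarTreeRow` OPEN; RATE class (log\*) / honest sentence of `run/shared/lean/prim/quant/README.md` unchanged.
[this work].  Nothing here is cited as a published result.  The gluing rows served [cite: KozmaNitzan2024, Conjecture 3 (p. 15)]; product measure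
[cite: Grimmett1999, §1.3 p. 10].
-/

noncomputable section

open scoped BigOperators

namespace Summit.CriticalPhenomena.PercolationContinuityZ3.Theorems
namespace Quant
namespace LawDec

open Finset

/-- the point mass `δ_K` -/
local notation3 "δ[" K "]" => (fun k : ℕ => if k = (K : ℕ) then (1 : ℝ) else 0)

/-- the FAR-GIANT PIECE / sub-forest law of shape `(lo, K)`: `S(γ) = {lo: 1−γ, lo+K: γ}` -/
local notation3 "SP[" lo ", " K ", " a "]" => (fun h : ℕ => (1 - (a : ℝ)) * (if h = (lo : ℕ) then (1 : ℝ) else 0) +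
  (a : ℝ) * (if h = (lo : ℕ) + (K : ℕ) then (1 : ℝ) else 0))

/-! ### The expansion for forests of glued siblings of shape `(lo, K)` -/

/-- re-association of the expansion term: `(sHub P ∗ flaw L) ∗ S(γ) = sHub (γ :: P) ∗ flaw L`. [this work] -/
theorem shapeForest_piece (lo K : ℕ) (P : List ℝ) (L : List Sib) (γ : ℝ) :
    lconv ((lo + K) * P.length + ftop L) (lo + K) (lconv ((lo + K) * P.length) (ftop L) (sHub lo K P) (flaw L)) SP[lo, K, γ]
      = lconv ((lo + K) * P.length + (lo + K)) (ftop L) (sHub lo K (γ :: P)) (flaw L) :=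
  calc lconv ((lo + K) * P.length + ftop L) (lo + K) (lconv ((lo + K) * P.length) (ftop L) (sHub lo K P) (flaw L)) SP[lo, K, γ]
      = lconv ((lo + K) * P.length) (ftop L + (lo + K)) (sHub lo K P) (lconv (ftop L) (lo + K) (flaw L) SP[lo, K, γ]) :=
        (lconv_assoc _ _ _ _ _ _).symm
    _ = lconv ((lo + K) * P.length) ((lo + K) + ftop L) (sHub lo K P) (lconv (lo + K) (ftop L) SP[lo, K, γ] (flaw L)) := by
        rw [lconv_comm (ftop L) (lo + K) (flaw L), Nat.add_comm (ftop L) (lo + K)]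
    _ = lconv ((lo + K) * P.length + (lo + K)) (ftop L) (lconv ((lo + K) * P.length) (lo + K) (sHub lo K P) SP[lo, K, γ]) (flaw L) :=
        lconv_assoc _ _ _ _ _ _
    _ = lconv ((lo + K) * P.length + (lo + K)) (ftop L) (sHub lo K (γ :: P)) (flaw L) := rfl

/-- `ftop` and `fmean` of a list of glued siblings of shape `(lo, K)`: `ftop = (lo+K)·length`, `x·ftop ≤ fmean`. [this work] -/
theorem shapeSibs_ftop_fmean (lo K : ℕ) {x : ℝ} : ∀ L : List Sib,
    (∀ s ∈ L, s.M = lo + K ∧ 0 < s.q ∧ s.q < 1 ∧ ∃ g : ℝ, 0 < g ∧ g < 1 ∧ s.ρ = SP[lo, K, g] ∧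
      2 * (lo : ℝ) ≤ s.q * ((lo : ℝ) + K * g) ∧ x ≤ s.q * g) →
    ftop L = (lo + K) * L.length ∧ x * (ftop L : ℝ) ≤ fmean L
  | [], _ => by simp [ftop, fmean]
  | s :: L, hL => by
    obtain ⟨hM, hq0, _, g, hg0, hg1, hρ, _, hxg⟩ := hL s (by simp)
    obtain ⟨ih1, ih2⟩ := shapeSibs_ftop_fmean lo K L (fun s' h' => hL s' (List.mem_cons_of_mem s h'))
    have hmean : s.mean = (lo : ℝ) + K * g := by
      unfold Sib.mean; rw [hM, hρ]; exact (sp_laws lo K hg0.le hg1.le).2.2.2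
    simp only [ftop, fmean, List.length_cons, hM, hmean]
    refine ⟨by rw [ih1]; ring, ?_⟩
    push_cast
    have hB : (0 : ℝ) ≤ (lo : ℝ) + K := by positivity
    have h1 := mul_le_mul_of_nonneg_right hxg hB
    have h2 : 0 ≤ s.q * (lo : ℝ) * (1 - g) := mul_nonneg (mul_nonneg hq0.le (Nat.cast_nonneg lo)) (by linarith)
    nlinarith [ih2, h1, h2]

/-- **THE INVARIANT** of the k-fold piece expansion for glued siblings of shape `(lo, K)` (`lo < K`, `2K ≤ 3lo`), `G = sHub P ∗ flaw L`:
(1) law facts (mean `Σ_P (lo + Kγ) + fmean L`); (2) `G` SDEC unless `|P| = 1 ∧ L = []`; (3) `G ∗ gate δ_B(θ)` SDEC for every big heavy blob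
`2lo ≤ Bθ`, `θ < 1`, `x ≤ θ` (`B = lo+K`). [this work] -/
theorem shapeForest_inv (lo K : ℕ) (hloK : lo < K) (hK32 : 2 * K ≤ 3 * lo) {x : ℝ} (hx0 : 0 < x) (hx1 : x < 1) : ∀ L : List Sib,
    (∀ s ∈ L, s.M = lo + K ∧ 0 < s.q ∧ s.q < 1 ∧ ∃ g : ℝ, 0 < g ∧ g < 1 ∧ s.ρ = SP[lo, K, g] ∧
      2 * (lo : ℝ) ≤ s.q * ((lo : ℝ) + K * g) ∧ x ≤ s.q * g) →
    ∀ P : List ℝ, (∀ γ ∈ P, (lo : ℝ) ≤ K * γ ∧ γ < 1 ∧ x * ((lo : ℝ) + K) ≤ lo + K * γ) →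
      ((∀ h, 0 ≤ lconv ((lo + K) * P.length) (ftop L) (sHub lo K P) (flaw L) h) ∧
        (∀ h, (lo + K) * P.length + ftop L < h → lconv ((lo + K) * P.length) (ftop L) (sHub lo K P) (flaw L) h = 0) ∧
        ∑ h ∈ Finset.range ((lo + K) * P.length + ftop L + 1), lconv ((lo + K) * P.length) (ftop L) (sHub lo K P) (flaw L) h = 1 ∧
        ∑ h ∈ Finset.range ((lo + K) * P.length + ftop L + 1), (h : ℝ) * lconv ((lo + K) * P.length) (ftop L) (sHub lo K P) (flaw L) h
          = (P.map (fun γ => (lo : ℝ) + K * γ)).sum + fmean L) ∧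
      ((P.length ≠ 1 ∨ L ≠ []) → SDEC x ((lo + K) * P.length + ftop L) (lconv ((lo + K) * P.length) (ftop L) (sHub lo K P) (flaw L))) ∧
      (∀ θ : ℝ, 2 * (lo : ℝ) ≤ ((lo : ℝ) + K) * θ → θ < 1 → x ≤ θ →
        SDEC x ((lo + K) * P.length + ftop L + (lo + K))
          (lconv ((lo + K) * P.length + ftop L) (lo + K) (lconv ((lo + K) * P.length) (ftop L) (sHub lo K P) (flaw L)) (gate δ[lo + K] θ)))
  | [], _ => by
    intro P hP
    have hK2 : K ≤ 2 * lo := by omega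
    have hlo : 1 ≤ lo := by omega
    have hloR : (1 : ℝ) ≤ lo := by exact_mod_cast hlo
    have hKR : (lo : ℝ) < K := by exact_mod_cast hloK
    have hK2R : (K : ℝ) ≤ 2 * lo := by exact_mod_cast hK2
    have hhalf : ∀ γ ∈ P, 1 / 2 ≤ γ := fun γ h => by have := (hP γ h).1; nlinarith
    have hP01 : ∀ γ ∈ P, 0 ≤ γ ∧ γ ≤ 1 := fun γ h => ⟨by linarith [hhalf γ h], (hP γ h).2.1.le⟩
    obtain ⟨a0, aM, a1, am⟩ := sHub_laws lo K P hP01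
    have eG : lconv ((lo + K) * P.length) (ftop []) (sHub lo K P) (flaw []) = sHub lo K P := by
      funext h; exact lconv_delta_right _ _ _ aM h
    have eT : (lo + K) * P.length + ftop [] = (lo + K) * P.length := rfl
    rw [eG, eT]
    have hfm : fmean [] = 0 := rfl
    rw [hfm, add_zero]
    obtain ⟨hlo', _⟩ := shape_sum_bounds lo K x P (fun γ h => ⟨(hP γ h).2.1, (hP γ h).2.2⟩)
    have hta : x * (((lo + K) * P.length : ℕ) : ℝ) ≤ (P.map (fun γ => (lo : ℝ) + K * γ)).sum := by push_cast; linarith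
    have c2 : (P.length ≠ 1 ∨ ([] : List Sib) ≠ []) → SDEC x ((lo + K) * P.length) (sHub lo K P) := by
      intro hc
      have hne : P.length ≠ 1 := by
        rcases hc with h | h
        · exact h
        · exact absurd rfl h
      rcases Nat.lt_or_ge P.length 2 with hlt | hge
      · have h0 : P.length = 0 := by omega
        rw [h0, Nat.mul_zero]
        intro q _ _ j' hj'
        omega
      · exact sdec_sHub lo K hloK hK32 hx0 P hge hP
    refine ⟨⟨a0, aM, a1, am⟩, c2, fun θ hθ hθ1 hxθ => ?_⟩
    by_cases h1 : P.length = 1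
    · -- a lone far-giant piece beside a big heavy blob: `sdec_pieceBlob`
      obtain ⟨γ, rfl⟩ : ∃ γ, P = [γ] := by
        rcases P with _ | ⟨γ, _ | ⟨γ', P'⟩⟩
        · simp at h1
        · exact ⟨γ, rfl⟩
        · simp at h1
      have hγ := hP γ (by simp)
      have cM : ∀ h, lo + K < h → SP[lo, K, γ] h = 0 := (sp_laws lo K (by linarith [hhalf γ (by simp)]) hγ.2.1.le).2.1
      have e0 : sHub lo K [γ] = SP[lo, K, γ] := funext fun h => lconv_delta_left _ (lo + K) _ cM h
      have e1 : (lo + K) * [γ].length = lo + K := by simp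
      rw [e1, e0, lconv_comm (lo + K) (lo + K), show lo + K + (lo + K) = 2 * lo + 2 * K by ring]
      exact sdec_pieceBlob lo K hloK hK2 hx0 (hhalf γ (by simp)) hγ.2.1 (by nlinarith) hθ1 hθ hxθ hγ.2.2
    · exact (sdec_blob_step (lo + K) hx0 hx1 hxθ hθ1.le a0 aM a1 am hta (c2 (Or.inl h1))).2.2.2.2
  | s :: L, hL => by
    intro P hP
    have hK2 : K ≤ 2 * lo := by omega
    have hlo : 1 ≤ lo := by omega
    have hK1 : 1 ≤ K := by omega
    have hloR : (1 : ℝ) ≤ lo := by exact_mod_cast hlo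
    have hKR : (lo : ℝ) < K := by exact_mod_cast hloK
    have hB0 : (0 : ℝ) < (lo : ℝ) + K := by linarith
    have hK0 : (0 : ℝ) < K := by linarith
    obtain ⟨hM, hq0, hq1, g, hg0, hg1, hρ, hm, hxg⟩ := hL s (by simp)
    have hL' : ∀ s' ∈ L, s'.M = lo + K ∧ 0 < s'.q ∧ s'.q < 1 ∧ ∃ g : ℝ, 0 < g ∧ g < 1 ∧ s'.ρ = SP[lo, K, g] ∧
        2 * (lo : ℝ) ≤ s'.q * ((lo : ℝ) + K * g) ∧ x ≤ s'.q * g := fun s' h' => hL s' (List.mem_cons_of_mem s h')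
    obtain ⟨q, x₁, n, M, ρ⟩ := s
    simp only at hM hq0 hq1 hρ hm hxg
    subst hM
    subst hρ
    -- parameters of the glued sibling
    set m : ℝ := q * ((lo : ℝ) + K * g) with hmdef
    set α : ℝ := ((lo : ℝ) + K) * (1 - q) / (((lo : ℝ) + K) - m) with hα
    set γ : ℝ := (m - lo) / K with hγ
    set θs : ℝ := m / ((lo : ℝ) + K) with hθs
    obtain ⟨_, hα0, hα1, hbigs, hθs1, hxθs, hloγ, hγh, hγ1, hxP⟩ := shapeSib_params lo K hloK hK2 hq0 hq1 hg1 hm hxg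
    have hθs0 : 0 ≤ θs := le_trans hx0.le hxθs
    have hQ : ∀ γ' ∈ γ :: P, (lo : ℝ) ≤ K * γ' ∧ γ' < 1 ∧ x * ((lo : ℝ) + K) ≤ lo + K * γ' := by
      intro γ' h'
      rcases List.mem_cons.1 h' with rfl | h'
      · exact ⟨hloγ, hγ1, hxP⟩
      · exact hP γ' h'
    obtain ⟨⟨a0, aM, a1, am⟩, _, a3⟩ := shapeForest_inv lo K hloK hK32 hx0 hx1 L hL' P hP
    obtain ⟨⟨b0, bM, b1, bm⟩, b2, _⟩ := shapeForest_inv lo K hloK hK32 hx0 hx1 L hL' (γ :: P) hQ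
    obtain ⟨hft, hfm⟩ := shapeSibs_ftop_fmean lo K L hL'
    obtain ⟨hlo', _⟩ := shape_sum_bounds lo K x P (fun γ' h => ⟨(hP γ' h).2.1, (hP γ' h).2.2⟩)
    set N : ℕ := (lo + K) * P.length + ftop L with hN
    set G : ℕ → ℝ := lconv ((lo + K) * P.length) (ftop L) (sHub lo K P) (flaw L) with hG
    set X₁ : ℕ → ℝ := lconv N (lo + K) G (gate δ[lo + K] θs) with hX₁
    set X₂ : ℕ → ℝ := lconv ((lo + K) * P.length + (lo + K)) (ftop L) (sHub lo K (γ :: P)) (flaw L) with hX₂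
    have hsmean : Sib.mean ⟨q, x₁, n, lo + K, SP[lo, K, g]⟩ = (lo : ℝ) + K * g := (sp_laws lo K hg0.le hg1.le).2.2.2
    have eflaw : flaw (⟨q, x₁, n, lo + K, SP[lo, K, g]⟩ :: L) = lconv (ftop L) (lo + K) (flaw L) (gate SP[lo, K, g] q) := rfl
    have eftop : ftop (⟨q, x₁, n, lo + K, SP[lo, K, g]⟩ :: L) = ftop L + (lo + K) := rfl
    have efmean : fmean (⟨q, x₁, n, lo + K, SP[lo, K, g]⟩ :: L) = fmean L + m := by
      show fmean L + q * Sib.mean ⟨q, x₁, n, lo + K, SP[lo, K, g]⟩ = _; rw [hsmean]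
    rw [eflaw, eftop, efmean]
    simp only [List.length_cons] at b0 bM b1 bm b2
    rw [show (lo + K) * (P.length + 1) = (lo + K) * P.length + (lo + K) by ring] at b0 bM b1 bm b2
    rw [show (lo + K) * P.length + (lo + K) + ftop L = N + (lo + K) by rw [hN]; ring] at bM b1 bm b2
    -- the mixture identity
    have hmix : ∀ h, lconv ((lo + K) * P.length) (ftop L + (lo + K)) (sHub lo K P) (lconv (ftop L) (lo + K) (flaw L) (gate SP[lo, K, g] q)) h
        = α * X₁ h + (1 - α) * X₂ h := by
      intro h
      rw [lconv_assoc, lconv_mix_right _ _ _ _ _ _ α (fun k => gate_shapeSib_eq_mix lo K hlo hK1 hq1 hg0.le hg1.le k) h, hX₁, hX₂,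
        ← shapeForest_piece lo K P L γ]
    have eNt : (lo + K) * P.length + (ftop L + (lo + K)) = N + (lo + K) := by rw [hN]; ring
    rw [eNt]
    -- laws of `X₁`
    obtain ⟨bl0, _, bl1, blm⟩ := gateBlob_laws (lo + K) hθs0 hθs1.le
    obtain ⟨c0, cM, c1, cm⟩ := lconv_laws a0 a1 am bl0 bl1 blm
    have hX₁s : SDEC x (N + (lo + K)) X₁ := a3 θs hbigs hθs1 hxθs
    have eθm : (((lo + K : ℕ)) : ℝ) * θs = m := by rw [hθs]; push_cast; field_simp
    have eγm : (lo : ℝ) + K * γ = m := by rw [hγ]; field_simp; ring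
    have cm' : ∑ h ∈ Finset.range (N + (lo + K) + 1), (h : ℝ) * X₁ h = (P.map (fun γ => (lo : ℝ) + K * γ)).sum + (fmean L + m) := by
      rw [hX₁, cm, eθm]; ring
    have bm' : ∑ h ∈ Finset.range (N + (lo + K) + 1), (h : ℝ) * X₂ h = (P.map (fun γ => (lo : ℝ) + K * γ)).sum + (fmean L + m) := by
      rw [hX₂, bm]; simp only [List.map_cons, List.sum_cons]; rw [eγm]; ring
    have main : ((∀ h, 0 ≤ lconv ((lo + K) * P.length) (ftop L + (lo + K)) (sHub lo K P) (lconv (ftop L) (lo + K) (flaw L) (gate SP[lo, K, g] q)) h) ∧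
        (∀ h, N + (lo + K) < h →
          lconv ((lo + K) * P.length) (ftop L + (lo + K)) (sHub lo K P) (lconv (ftop L) (lo + K) (flaw L) (gate SP[lo, K, g] q)) h = 0) ∧
        ∑ h ∈ Finset.range (N + (lo + K) + 1),
          lconv ((lo + K) * P.length) (ftop L + (lo + K)) (sHub lo K P) (lconv (ftop L) (lo + K) (flaw L) (gate SP[lo, K, g] q)) h = 1 ∧
        ∑ h ∈ Finset.range (N + (lo + K) + 1),
          (h : ℝ) * lconv ((lo + K) * P.length) (ftop L + (lo + K)) (sHub lo K P) (lconv (ftop L) (lo + K) (flaw L) (gate SP[lo, K, g] q)) h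
          = (P.map (fun γ => (lo : ℝ) + K * γ)).sum + (fmean L + m)) ∧
        SDEC x (N + (lo + K)) (lconv ((lo + K) * P.length) (ftop L + (lo + K)) (sHub lo K P) (lconv (ftop L) (lo + K) (flaw L) (gate SP[lo, K, g] q))) := by
      by_cases hcorner : P = [] ∧ L = []
      · -- one glued sibling alone
        obtain ⟨rfl, rfl⟩ := hcorner
        obtain ⟨t0, tM, t1, tm⟩ := shapeSib_laws lo K hq0.le hq1.le hg0.le hg1.le
        have e1 : lconv (ftop []) (lo + K) (flaw []) (gate SP[lo, K, g] q) = gate SP[lo, K, g] q := funext fun h => lconv_delta_left 0 _ _ tM h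
        have eidx : ftop ([] : List Sib) + (lo + K) = lo + K := by show 0 + (lo + K) = lo + K; omega
        rw [eidx]
        have e2 : lconv ((lo + K) * ([] : List ℝ).length) (lo + K) (sHub lo K []) (gate SP[lo, K, g] q) = gate SP[lo, K, g] q :=
          funext fun h => lconv_delta_left _ _ _ tM h
        have hN3 : N + (lo + K) = lo + K := by rw [hN]; simp [ftop]
        rw [e1, e2, hN3]
        refine ⟨⟨t0, tM, t1, by rw [tm, hmdef]; simp [fmean]⟩, sdec_shapeSib lo K hlo hK1 hx0 hq0 hq1 hg1 hxg⟩
      · have hcond : (γ :: P).length ≠ 1 ∨ L ≠ [] := by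
          by_cases hPn : P = []
          · exact Or.inr (fun hLn => hcorner ⟨hPn, hLn⟩)
          · left; simp only [List.length_cons]; intro h; exact hPn (List.length_eq_zero_iff.1 (by omega))
        have hX₂s : SDEC x (N + (lo + K)) X₂ := b2 hcond
        obtain ⟨r0, rM, r1, rm, rS⟩ := sdec_mix_laws hα0 hα1 hmix c0 cM c1 cm' b0 bM b1 bm' hX₁s hX₂s
        exact ⟨⟨r0, rM, r1, rm⟩, rS⟩
    obtain ⟨⟨r0, rM, r1, rm⟩, rS⟩ := main
    refine ⟨⟨r0, rM, r1, rm⟩, fun _ => rS, fun θ hθ hθ1 hxθ => ?_⟩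
    have hta : x * ((N + (lo + K) : ℕ) : ℝ) ≤ (P.map (fun γ => (lo : ℝ) + K * γ)).sum + (fmean L + m) := by
      rw [hN]; push_cast
      have h1 : x * ((ftop L : ℕ) : ℝ) ≤ fmean L := hfm
      have h2 : x * ((lo : ℝ) + K) ≤ m := by rw [← eγm]; exact hxP
      have e : x * (((lo : ℝ) + K) * (P.length : ℝ) + (ftop L : ℕ) + ((lo : ℝ) + K))
          = x * ((lo : ℝ) + K) * (P.length : ℝ) + x * ((ftop L : ℕ) : ℝ) + x * ((lo : ℝ) + K) := by ring
      rw [e]; linarith [hlo', h1, h2]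
    exact (sdec_blob_step (lo + K) hx0 hx1 hxθ hθ1.le r0 rM r1 rm hta rS).2.2.2.2

/-- **EVERY FOREST OF GLUED SIBLINGS `R^lo[q₁](R^K[g₁]) ⊔ … ⊔ R^lo[q_k](R^K[g_k])` OF A COMMON SHAPE `lo < K ≤ 3lo/2`, EVERY WIDTH, IS SDEC AT EVERY
FLOOR `x ≤ min qᵢgᵢ` — ORACLE-FREE**, in the far-giant regime `mᵢ = qᵢ(lo + Kgᵢ) ≥ 2lo` (every sibling heavy-unfloored).  The sibling data:
`s = ⟨q, ·, ·, lo+K, S(g)⟩`, `S(g) = {lo: 1−g, lo+K: g}` (`= slice δ_lo K g`, arm-1 g49's `gluedSib lo K q g ·`). [this work] -/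
theorem sdec_shapeForest (lo K : ℕ) (hloK : lo < K) (hK32 : 2 * K ≤ 3 * lo) {x : ℝ} (hx0 : 0 < x) (L : List Sib)
    (hL : ∀ s ∈ L, s.M = lo + K ∧ 0 < s.q ∧ s.q < 1 ∧ ∃ g : ℝ, 0 < g ∧ g < 1 ∧ s.ρ = SP[lo, K, g] ∧
      2 * (lo : ℝ) ≤ s.q * ((lo : ℝ) + K * g) ∧ x ≤ s.q * g) :
    SDEC x (ftop L) (flaw L) := by
  by_cases hnil : L = []
  · subst hnil; intro q _ _ j' hj'; exact absurd hj' (Nat.not_lt_zero _)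
  · obtain ⟨s, hs⟩ := List.exists_mem_of_ne_nil L hnil
    have hx1 : x < 1 := by
      obtain ⟨_, hq0, hq1, g, hg0, hg1, _, _, hxg⟩ := hL s hs
      nlinarith
    have hLaw : ∀ s ∈ L, s.LawOK := by
      intro s hs
      obtain ⟨hM, hq0, hq1, g, hg0, hg1, hρ, _, _⟩ := hL s hs
      obtain ⟨c0, cM, c1, _⟩ := sp_laws lo K hg0.le hg1.le
      refine ⟨hq0, hq1, ?_, ?_, ?_⟩
      · intro h; rw [hρ]; exact c0 h
      · intro h hh; rw [hρ]; exact cM h (by rw [hM] at hh; exact hh)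
      · rw [hM, hρ]; exact c1
    obtain ⟨_, fM, _, _⟩ := flaw_facts L hLaw
    have h := (shapeForest_inv lo K hloK hK32 hx0 hx1 L hL [] (fun γ h => by simp at h)).2.1 (Or.inl (by simp))
    have e : lconv ((lo + K) * ([] : List ℝ).length) (ftop L) (sHub lo K []) (flaw L) = flaw L := funext fun k => lconv_delta_left _ _ _ fM k
    rw [e] at h
    simpa using h

end LawDec
end Quant
end Summit.CriticalPhenomena.PercolationContinuityZ3.Theorems
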